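import Mathlib
import HarnessLib
import Summits.NavierStokesRegularity.NavierStokesRegularity.Theorems.ChiralWindowDoorDefs
import Summits.NavierStokesRegularity.NavierStokesRegularity.Theorems.ChiralWindowDoorLambda

/-!
# Door S20 «ChiralWindowDoor» — tools for the zoom crux K1: `Λ f_j(y) → Λ g(y)` by three zones

Door S20 of nsreg-p1's local Type-I door family (`HOME/ns-regularity-ideate-p1/r19/R19-LINE.md`; DESIGN-ONLY, route NOT
born).  The pure-analysis convergence lemma behind the passage of the NON-LOCAL chirality functional `curl − Λ` to the
limit along the parabolic point zoom (K1 `LocalPointZoomChiralWindow`):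

* `tendsto_fracLapHalf_of_zones` — **`fracLapHalf (f j) y → fracLapHalf g y`** for fields `f_j → g` converging
  POINTWISE everywhere, with (eventually) integrable `Λ`-integrands at `y`, a uniform quadratic bound on the second
  differences of `f_j` at `y` for `‖z‖ < r₀` (zone 1: dominated by `‖z‖⁻²`), uniform bounds on every ball about `y`
  (zone 2: dominated by a constant on a ball), and tails `∫_{‖z‖≥L₀} lamK‖δ²f_j(y,z)‖` that are uniformly small for `L₀`
  large (zone 3; the NS-specific far-field bookkeeping — local Type I up to radius `ρ/μ_j`, Leray–Hopf energy
  beyond — lives in `…ChiralWindowDoorZoomLambdaTools.integral_tail_shift_le` and the zoom file).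

Seat nsreg-p6 g12 (THEOREMS-ONLY door sequels, DIRECTOR-NS g8 #32 (2)/#36).  WHAT THIS IS NOT: not NS regularity
(Clay A); not K1 — an analysis lemma (dominated convergence on a ball + uniformly small tails); no route is opened.
-/

noncomputable section

-- the summit and its single sub-problem share the name (CONVENTIONS §1), as in every Theorems file
set_option linter.dupNamespace false

namespace Summit.NavierStokesRegularity.NavierStokesRegularity.Theorems.ChiralWindowDoorZoomLambdaLimit

open MeasureTheory Set Filter Topology Metric Function
open scoped RealInnerProductSpace
open Summit.NavierStokesRegularity.NavierStokesRegularity.Theorems.ChiralWindowDoorDefs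
open Summit.NavierStokesRegularity.NavierStokesRegularity.Theorems.ChiralWindowDoorLambda (lamK_mul_sq_le)

/-! ### Continuity of `Λ` along the zoom: the three-zone lemma -/

/-- **`Λ f_j(y) → Λ g(y)` by three zones.**  Let `f_j → g` pointwise everywhere, with (eventually in `j`) integrable
`Λ`-integrands at `y`, a uniform quadratic bound on the second differences of `f_j` at `y` for `‖z‖ < r₀` (zone 1),
uniform bounds on every ball about `y` (zone 2), and tails `∫_{‖z‖≥L₀} lamK‖δ²f_j(y,z)‖` that are uniformly small for
`L₀` large (zone 3; likewise for `g`).  Then `fracLapHalf (f j) y → fracLapHalf g y`. -/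
theorem tendsto_fracLapHalf_of_zones {f : ℕ → EuclideanSpace ℝ (Fin 3) → EuclideanSpace ℝ (Fin 3)}
    {g : EuclideanSpace ℝ (Fin 3) → EuclideanSpace ℝ (Fin 3)} {y : EuclideanSpace ℝ (Fin 3)} {r₀ A : ℝ}
    (hr₀ : 0 < r₀) (hA : 0 ≤ A)
    (hint : ∀ᶠ j in atTop, Integrable (fun z => lamK z • ((2 : ℝ) • f j y - f j (y + z) - f j (y - z))))
    (hgint : Integrable (fun z => lamK z • ((2 : ℝ) • g y - g (y + z) - g (y - z))))
    (hpt : ∀ y', Tendsto (fun j => f j y') atTop (𝓝 (g y')))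
    (hnear : ∀ᶠ j in atTop, ∀ z : EuclideanSpace ℝ (Fin 3), ‖z‖ < r₀ →
      ‖(2 : ℝ) • f j y - f j (y + z) - f j (y - z)‖ ≤ A * ‖z‖ ^ 2)
    (hball : ∀ L : ℝ, 0 < L → ∃ B : ℝ, ∀ᶠ j in atTop, ∀ y' ∈ ball y L, ‖f j y'‖ ≤ B)
    (htail : ∀ ε > 0, ∃ L₀ : ℝ, 0 < L₀ ∧
      (∀ᶠ j in atTop, ∫ z in (ball (0 : EuclideanSpace ℝ (Fin 3)) L₀)ᶜ,
        lamK z * ‖(2 : ℝ) • f j y - f j (y + z) - f j (y - z)‖ ≤ ε) ∧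
      ∫ z in (ball (0 : EuclideanSpace ℝ (Fin 3)) L₀)ᶜ, lamK z * ‖(2 : ℝ) • g y - g (y + z) - g (y - z)‖ ≤ ε) :
    Tendsto (fun j => fracLapHalf (f j) y) atTop (𝓝 (fracLapHalf g y)) := by
  set F : ℕ → EuclideanSpace ℝ (Fin 3) → EuclideanSpace ℝ (Fin 3) :=
    fun j z => lamK z • ((2 : ℝ) • f j y - f j (y + z) - f j (y - z)) with hF
  set G : EuclideanSpace ℝ (Fin 3) → EuclideanSpace ℝ (Fin 3) :=
    fun z => lamK z • ((2 : ℝ) • g y - g (y + z) - g (y - z)) with hG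
  have hnF : ∀ j z, ‖F j z‖ = lamK z * ‖(2 : ℝ) • f j y - f j (y + z) - f j (y - z)‖ := fun j z => by
    rw [hF]; simp only; rw [norm_smul, Real.norm_eq_abs, abs_of_nonneg (lamK_nonneg z)]
  have hnG : ∀ z, ‖G z‖ = lamK z * ‖(2 : ℝ) • g y - g (y + z) - g (y - z)‖ := fun z => by
    rw [hG]; simp only; rw [norm_smul, Real.norm_eq_abs, abs_of_nonneg (lamK_nonneg z)]
  refine Metric.tendsto_nhds.2 fun ε hε => ?_
  obtain ⟨L₀, hL₀, htf, htg⟩ := htail (ε / 4) (by positivity)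
  obtain ⟨B, hB⟩ := hball (L₀ + 1) (by positivity)
  set S : Set (EuclideanSpace ℝ (Fin 3)) := ball 0 L₀ with hS
  have hSm : MeasurableSet S := measurableSet_ball
  -- ## dominated convergence on the ball `S`
  set Bp : ℝ := max B 0 with hBp
  have hBp0 : 0 ≤ Bp := le_max_right _ _
  set bound : EuclideanSpace ℝ (Fin 3) → ℝ := fun z =>
    (ball (0 : EuclideanSpace ℝ (Fin 3)) r₀).indicator (fun z => (1 / Real.pi ^ 2 * A) * ‖z‖ ^ (-(2 : ℝ))) z +
      4 * Bp * (1 / Real.pi ^ 2 * (r₀ ^ 4)⁻¹) with hbound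
  have hbound_int : Integrable bound (volume.restrict S) := by
    refine Integrable.add ?_ (integrableOn_const measure_ball_lt_top.ne)
    refine (IntegrableOn.integrable_indicator ?_ measurableSet_ball).integrableOn
    have hmeas : Measurable fun w : EuclideanSpace ℝ (Fin 3) => (1 / Real.pi ^ 2 * A) * ‖w‖ ^ (-(2 : ℝ)) :=
      Measurable.const_mul (continuous_norm.measurable.pow_const _) _
    exact integrableOn_ball_of_norm_le_rpow (E := EuclideanSpace ℝ (Fin 3)) (F := ℝ) (μ := volume)
      (f := fun w => (1 / Real.pi ^ 2 * A) * ‖w‖ ^ (-(2 : ℝ)))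
      (by rw [finrank_euclideanSpace_fin]; norm_num) (C := 1 / Real.pi ^ 2 * A) (α := 2) (r := r₀)
      (by rw [finrank_euclideanSpace_fin]; norm_num)
      (ae_of_all _ fun w => by rw [Real.norm_eq_abs, abs_of_nonneg (by positivity)])
      hmeas.aestronglyMeasurable
  have h_meas : ∀ᶠ j in atTop, AEStronglyMeasurable (F j) (volume.restrict S) := by
    filter_upwards [hint] with j hj using hj.aestronglyMeasurable.restrict
  have h_bd : ∀ᶠ j in atTop, ∀ᵐ z ∂(volume.restrict S), ‖F j z‖ ≤ bound z := by
    filter_upwards [hnear, hB] with j hjn hjB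
    refine (ae_restrict_iff' hSm).2 (ae_of_all _ fun z hz => ?_)
    have hzL : ‖z‖ < L₀ := by simpa [hS, mem_ball, dist_zero_right] using hz
    rw [hnF, hbound]
    by_cases hzr : ‖z‖ < r₀
    · have hmem : z ∈ ball (0 : EuclideanSpace ℝ (Fin 3)) r₀ := by simpa [mem_ball, dist_zero_right] using hzr
      simp only
      rw [indicator_of_mem hmem]
      have h1 : lamK z * ‖(2 : ℝ) • f j y - f j (y + z) - f j (y - z)‖ ≤ (1 / Real.pi ^ 2 * A) * ‖z‖ ^ (-(2 : ℝ)) :=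
        (mul_le_mul_of_nonneg_left (hjn z hzr) (lamK_nonneg z)).trans (lamK_mul_sq_le hA z)
      have h2 : 0 ≤ 4 * Bp * (1 / Real.pi ^ 2 * (r₀ ^ 4)⁻¹) := by positivity
      linarith
    · have hmem : z ∉ ball (0 : EuclideanSpace ℝ (Fin 3)) r₀ := by
        simpa [mem_ball, dist_zero_right] using hzr
      simp only
      rw [indicator_of_notMem hmem, zero_add]
      have hy0 : y ∈ ball y (L₀ + 1) := mem_ball_self (by positivity)
      have hy1 : y + z ∈ ball y (L₀ + 1) := by
        rw [mem_ball, dist_eq_norm, add_sub_cancel_left]; linarith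
      have hy2 : y - z ∈ ball y (L₀ + 1) := by
        rw [mem_ball, dist_eq_norm, sub_sub_cancel_left, norm_neg]; linarith
      have hδ : ‖(2 : ℝ) • f j y - f j (y + z) - f j (y - z)‖ ≤ 4 * Bp := by
        calc ‖(2 : ℝ) • f j y - f j (y + z) - f j (y - z)‖
            ≤ ‖(2 : ℝ) • f j y‖ + ‖f j (y + z)‖ + ‖f j (y - z)‖ := by
              calc _ ≤ ‖(2 : ℝ) • f j y - f j (y + z)‖ + ‖f j (y - z)‖ := norm_sub_le _ _
                _ ≤ _ := by gcongr; exact norm_sub_le _ _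
          _ ≤ 2 * Bp + Bp + Bp := by
              rw [norm_smul, Real.norm_eq_abs, abs_of_pos (by norm_num : (0 : ℝ) < 2)]
              gcongr
              · exact (hjB _ hy0).trans (le_max_left _ _)
              · exact (hjB _ hy1).trans (le_max_left _ _)
              · exact (hjB _ hy2).trans (le_max_left _ _)
          _ = 4 * Bp := by ring
      have hK : lamK z ≤ 1 / Real.pi ^ 2 * (r₀ ^ 4)⁻¹ := by
        unfold lamK
        exact mul_le_mul_of_nonneg_left (inv_anti₀ (by positivity) (pow_le_pow_left₀ hr₀.le (not_lt.1 hzr) 4))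
          (by positivity)
      calc lamK z * ‖(2 : ℝ) • f j y - f j (y + z) - f j (y - z)‖ ≤ (1 / Real.pi ^ 2 * (r₀ ^ 4)⁻¹) * (4 * Bp) :=
            mul_le_mul hK hδ (norm_nonneg _) (by positivity)
        _ = 4 * Bp * (1 / Real.pi ^ 2 * (r₀ ^ 4)⁻¹) := by ring
  have h_lim : ∀ᵐ z ∂(volume.restrict S), Tendsto (fun j => F j z) atTop (𝓝 (G z)) := by
    refine ae_of_all _ fun z => ?_
    rw [hF, hG]
    exact ((((hpt y).const_smul (2 : ℝ)).sub (hpt (y + z))).sub (hpt (y - z))).const_smul (lamK z)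
  have hDC := tendsto_integral_filter_of_dominated_convergence bound h_meas h_bd hbound_int h_lim
  have hDCε : ∀ᶠ j in atTop, dist (∫ z in S, F j z) (∫ z in S, G z) < ε / 4 :=
    Metric.tendsto_nhds.1 hDC (ε / 4) (by positivity)
  -- ## assemble
  filter_upwards [hint, htf, hDCε] with j hjint hjt hjDC
  have hsplitF : ∫ z, F j z = (∫ z in S, F j z) + ∫ z in Sᶜ, F j z := (integral_add_compl hSm hjint).symm
  have hsplitG : ∫ z, G z = (∫ z in S, G z) + ∫ z in Sᶜ, G z := (integral_add_compl hSm hgint).symm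
  have htF : ‖∫ z in Sᶜ, F j z‖ ≤ ε / 4 := by
    refine (norm_integral_le_integral_norm _).trans ?_
    simp_rw [hnF]
    exact hjt
  have htG : ‖∫ z in Sᶜ, G z‖ ≤ ε / 4 := by
    refine (norm_integral_le_integral_norm _).trans ?_
    simp_rw [hnG]
    exact htg
  have e : fracLapHalf (f j) y - fracLapHalf g y =
      (1 / 2 : ℝ) • (((∫ z in S, F j z) - ∫ z in S, G z) + ((∫ z in Sᶜ, F j z) - ∫ z in Sᶜ, G z)) := by
    unfold fracLapHalf
    rw [← smul_sub]
    congr 1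
    show (∫ z, F j z) - ∫ z, G z = _
    rw [hsplitF, hsplitG]
    abel
  rw [dist_eq_norm, e, norm_smul, Real.norm_eq_abs, abs_of_pos (by norm_num : (0 : ℝ) < 1 / 2)]
  rw [dist_eq_norm] at hjDC
  have htri : ‖((∫ z in S, F j z) - ∫ z in S, G z) + ((∫ z in Sᶜ, F j z) - ∫ z in Sᶜ, G z)‖ ≤
      ‖(∫ z in S, F j z) - ∫ z in S, G z‖ + (‖∫ z in Sᶜ, F j z‖ + ‖∫ z in Sᶜ, G z‖) :=
    (norm_add_le _ _).trans (add_le_add le_rfl (norm_sub_le _ _))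
  nlinarith [htri, hjDC, htF, htG, norm_nonneg (((∫ z in S, F j z) - ∫ z in S, G z) + ((∫ z in Sᶜ, F j z) - ∫ z in Sᶜ, G z))]

end Summit.NavierStokesRegularity.NavierStokesRegularity.Theorems.ChiralWindowDoorZoomLambdaLimit

end
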